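import Literature.Geometry.Lorentzian.RicciVariationScalarCore
import HarnessLib

/-!
# Uniform control `|R_t − R| ≤ |t| K (1 + r)⁻⁴` of the scalar curvatures of `ds²_t = ds² + t Ric`
# (Schoen–Yau 1979, (3.28)–(3.29)): the compact core and the global bound

The scalar curvatures `R_t` of the metrics `ds²_t = ds² + t Ric` of the proof of Thm. 2 of
Schoen–Yau (Comm. Math. Phys. 65 (1979), pp. 72–74) are controlled *uniformly for `t` small*
((3.28)–(3.29), p. 73), which is what the differentiation of the mass integral (3.27)–(3.30) under
the integral sign needs. `RicciVariationScalarDecay.lean` gives the far region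
(`|R_t − R| ≤ |t| K ‖coord‖⁻⁴` on `far R₁`), `RicciVariationScalarCore.lean` the local bound near
every point. This file assembles them:

* `AFEnd.exists_core_abs_scalarCurvature_ricciFamily_sub_le` — on the compact complement of a far
  region (`isCompact_compl_far`), `|R_t − R| ≤ |t| M` for `|t| < s₀` (finite subcover of the local
  bounds);
* `AFEnd.exists_abs_scalarCurvature_ricciFamily_sub_le` — **global bound**: `τ₂ ∈ (0, τ]` and
  `K ≥ 0` with `|R(D_t)(x) − R(h)(x)| ≤ |t| K (1 + ‖coord x‖)⁻⁴` for all `x ∈ X` and `|t| < τ₂`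
  (`coord = 0` off the end, `≤ R₁` on the core, `> R₁` on the far region).

All results are proved; no definitions, no named facts.

## References

* R. Schoen, S.-T. Yau, *On the proof of the positive mass conjecture in general relativity*,
  Comm. Math. Phys. 65 (1979) 45–76, §3, the family `ds²_t` (p. 72) and (3.27)–(3.29) (p. 73).
-/

noncomputable section

open Set Function Filter Metric TopologicalSpace Manifold Bundle
open scoped Topology ContDiff Manifold

namespace Literature.Geometry.Lorentzian

namespace AFEnd

variable {X : Type} [TopologicalSpace X] [ChartedSpace E3 X] [IsManifold (𝓡 3) ∞ X]
  (e : AFEnd X) (D : InitialDataSet (𝓡 3) X)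

omit [IsManifold (𝓡 3) ∞ X] in
/-- Off the end, `coord` is the junk value `0`. [folklore] -/
private theorem coord_of_not_mem₅ {q : X} (hq : q ∉ e.U) : e.coord q = 0 := by
  classical
  exact dif_neg hq

omit [IsManifold (𝓡 3) ∞ X] in
/-- Outside `far R₁`, `‖coord‖ ≤ R₁` (`R₁ ≥ 0`). [folklore] -/
theorem norm_coord_le_of_not_mem_far {R₁ : ℝ} (hR₁ : 0 ≤ R₁) {x : X} (hx : x ∉ e.far R₁) :
    ‖e.coord x‖ ≤ R₁ := by
  by_cases hxU : x ∈ e.U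
  · by_contra h
    exact hx (e.mem_far_iff_coord.2 ⟨hxU, not_le.1 h⟩)
  · rw [e.coord_of_not_mem₅ hxU, norm_zero]
    exact hR₁

/-- **Core bound** (Schoen–Yau 1979, (3.28)–(3.29) on the compact part): for data `D` and a
family `D_t`, `|t| < τ`, with metric `h + t Ric(h)` pointwise on a one-ended `X`, and any radius
`R₁`, there are `s₀ ∈ (0, τ]` and `M ≥ 0` with `|R(D_t)(x) − R(h)(x)| ≤ |t| M` for all `x`
outside `far R₁` and `|t| < s₀` (the complement of `far R₁` is compact; finite subcover of the
local bounds `exists_nhds_abs_scalarCurvature_ricciFamily_sub_le`).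
[cite: SchoenYauPMT1979, (3.28)–(3.29) (p. 73)] -/
theorem exists_core_abs_scalarCurvature_ricciFamily_sub_le [D.metric.HasLeviCivita]
    (hsole : e.IsSoleEnd) {τ : ℝ} (hτ : 0 < τ) (Dt : ℝ → InitialDataSet (𝓡 3) X)
    (hDt : ∀ t : ℝ, |t| < τ → ∀ (x : X) (v w : TangentSpace (𝓡 3) x),
      (Dt t).metric.val x v w = D.metric.val x v w + t * D.metric.ricci x v w) (R₁ : ℝ) :
    ∃ s₀ M : ℝ, 0 < s₀ ∧ s₀ ≤ τ ∧ 0 ≤ M ∧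
      ∀ t : ℝ, |t| < s₀ → ∀ x : X, x ∉ e.far R₁ →
        |(Dt t).scalarCurvatureFn x - D.scalarCurvatureFn x| ≤ |t| * M := by
  classical
  choose U s M hUo hxU hs0 hsτ hM0 hloc using
    fun x₀ : X ↦ exists_nhds_abs_scalarCurvature_ricciFamily_sub_le D hτ Dt hDt x₀
  have hK : IsCompact (e.far R₁)ᶜ := isCompact_compl_far hsole R₁
  obtain ⟨T, -, hTcov⟩ := hK.elim_nhds_subcover U fun x _ ↦ (hUo x).mem_nhds (hxU x)
  rcases T.eq_empty_or_nonempty with hT | hT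
  · -- empty core: the statement is vacuous
    refine ⟨τ, 0, hτ, le_rfl, le_rfl, fun t _ x hx ↦ ?_⟩
    have : x ∈ (⋃ y ∈ T, U y) := hTcov hx
    rw [hT] at this
    simp at this
  · set s₀ : ℝ := T.inf' hT s with hs₀
    set Mtot : ℝ := ∑ y ∈ T, M y with hMtot
    have hs₀0 : 0 < s₀ := (Finset.lt_inf'_iff hT).2 fun y _ ↦ hs0 y
    obtain ⟨y₀, hy₀⟩ := hT
    have hs₀τ : s₀ ≤ τ := (Finset.inf'_le s hy₀).trans (hsτ y₀)
    refine ⟨s₀, Mtot, hs₀0, hs₀τ, Finset.sum_nonneg fun y _ ↦ hM0 y, fun t ht x hx ↦ ?_⟩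
    have hxcov : x ∈ ⋃ y ∈ T, U y := hTcov hx
    simp only [mem_iUnion, exists_prop] at hxcov
    obtain ⟨y, hyT, hxy⟩ := hxcov
    have hty : |t| < s y := ht.trans_le (Finset.inf'_le s hyT)
    have h := hloc y t hty x hxy
    have hMy : M y ≤ Mtot := Finset.single_le_sum (fun z _ ↦ hM0 z) hyT
    exact h.trans (mul_le_mul_of_nonneg_left hMy (abs_nonneg t))

/-- `r⁻⁴ ≤ (1 + R₁⁻¹)⁴ (1 + r)⁻⁴` for `0 < R₁ ≤ r`. [folklore] -/
private theorem rpow_neg_four_le {R₁ r : ℝ} (hR₁ : 0 < R₁) (hr : R₁ ≤ r) :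
    r ^ (-4 : ℝ) ≤ (1 + R₁⁻¹) ^ 4 * (1 + r) ^ (-4 : ℝ) := by
  have hr0 : 0 < r := hR₁.trans_le hr
  have h1 : r ^ (-4 : ℝ) = (r ^ 4)⁻¹ := by
    rw [Real.rpow_neg hr0.le, show (4 : ℝ) = ((4 : ℕ) : ℝ) by norm_num, Real.rpow_natCast]
  have h2 : (1 + r) ^ (-4 : ℝ) = ((1 + r) ^ 4)⁻¹ := by
    rw [Real.rpow_neg (by linarith), show (4 : ℝ) = ((4 : ℕ) : ℝ) by norm_num, Real.rpow_natCast]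
  rw [h1, h2]
  have hkey : (1 + r) ^ 4 ≤ ((1 + R₁⁻¹) * r) ^ 4 := by
    refine pow_le_pow_left₀ (by linarith) ?_ 4
    have : 1 ≤ R₁⁻¹ * r := by
      rw [inv_mul_eq_div, le_div_iff₀ hR₁, one_mul]
      exact hr
    nlinarith
  rw [mul_pow] at hkey
  have hr4 : 0 < r ^ 4 := by positivity
  have h1r : 0 < (1 + r) ^ 4 := by positivity
  rw [← div_eq_mul_inv, le_div_iff₀ h1r, inv_mul_le_iff₀ hr4]
  linarith

/-- **Global bound: `|R_t − R| ≤ |t| K (1 + ‖coord‖)⁻⁴`** (Schoen–Yau 1979, (3.28)–(3.29): the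
scalar curvatures of `ds²_t = ds² + t Ric` and their difference quotients are dominated by an
integrable weight, uniformly for `t` small). For data `D` with `h − δ = o₅(r⁻²)` on the only end
`e` and a family `D_t`, `|t| < τ`, with metric `h + t Ric(h)` pointwise, there are `τ₂ ∈ (0, τ]`
and `K ≥ 0` with `|R(D_t)(x) − R(h)(x)| ≤ |t| K (1 + ‖coord x‖)⁻⁴` for every `x ∈ X` and
`|t| < τ₂` — from the far estimate `exists_far_abs_scalarCurvature_ricciFamily_sub_le`
(`RicciVariationScalarDecay.lean`) and the core bound. [cite: SchoenYauPMT1979, (3.28)–(3.29) (p. 73)] -/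
theorem exists_abs_scalarCurvature_ricciFamily_sub_le [D.metric.HasLeviCivita]
    (haf : e.IsStronglyAsymptoticallyFlatWith D 0 2 0 5 0) (hsole : e.IsSoleEnd)
    {τ : ℝ} (hτ : 0 < τ) (Dt : ℝ → InitialDataSet (𝓡 3) X)
    (hDt : ∀ t : ℝ, |t| < τ → ∀ (x : X) (v w : TangentSpace (𝓡 3) x),
      (Dt t).metric.val x v w = D.metric.val x v w + t * D.metric.ricci x v w) :
    ∃ τ₂ K : ℝ, 0 < τ₂ ∧ τ₂ ≤ τ ∧ 0 ≤ K ∧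
      ∀ t : ℝ, |t| < τ₂ → ∀ x : X,
        |(Dt t).scalarCurvatureFn x - D.scalarCurvatureFn x| ≤
          |t| * K * (1 + ‖e.coord x‖) ^ (-4 : ℝ) := by
  obtain ⟨R₁, Kf, hRR₁, hKf0, hfar⟩ := e.exists_far_abs_scalarCurvature_ricciFamily_sub_le D haf
  obtain ⟨s₀, M, hs₀, hs₀τ, hM0, hcore⟩ :=
    e.exists_core_abs_scalarCurvature_ricciFamily_sub_le D hsole hτ Dt hDt R₁
  have hR₁0 : 0 < R₁ := e.R_pos.trans hRR₁
  set τ₂ : ℝ := min s₀ 1 with hτ₂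
  set K : ℝ := max (Kf * (1 + R₁⁻¹) ^ 4) (M * (1 + R₁) ^ 4) with hK
  have hK0 : 0 ≤ K := (by positivity : (0 : ℝ) ≤ Kf * (1 + R₁⁻¹) ^ 4).trans (le_max_left _ _)
  refine ⟨τ₂, K, lt_min hs₀ one_pos, (min_le_left _ _).trans hs₀τ, hK0, fun t ht x ↦ ?_⟩
  have hts : |t| < s₀ := ht.trans_le (min_le_left _ _)
  have ht1 : |t| ≤ 1 := (ht.trans_le (min_le_right _ _)).le
  have htτ : |t| < τ := hts.trans_le hs₀τ
  have hw0 : 0 ≤ (1 + ‖e.coord x‖) ^ (-4 : ℝ) := Real.rpow_nonneg (by positivity) _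
  by_cases hx : x ∈ e.far R₁
  · -- far region
    have h := hfar (Dt t) t ht1 (hDt t htτ) x hx
    obtain ⟨-, hxR⟩ := e.mem_far_iff_coord.1 hx
    have hle : ‖e.coord x‖ ^ (-4 : ℝ) ≤ (1 + R₁⁻¹) ^ 4 * (1 + ‖e.coord x‖) ^ (-4 : ℝ) :=
      rpow_neg_four_le hR₁0 hxR.le
    calc |(Dt t).scalarCurvatureFn x - D.scalarCurvatureFn x|
        ≤ |t| * Kf * ‖e.coord x‖ ^ (-4 : ℝ) := h
      _ ≤ |t| * Kf * ((1 + R₁⁻¹) ^ 4 * (1 + ‖e.coord x‖) ^ (-4 : ℝ)) :=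
          mul_le_mul_of_nonneg_left hle (by positivity)
      _ = |t| * (Kf * (1 + R₁⁻¹) ^ 4) * (1 + ‖e.coord x‖) ^ (-4 : ℝ) := by ring
      _ ≤ |t| * K * (1 + ‖e.coord x‖) ^ (-4 : ℝ) := by
          gcongr
          exact le_max_left _ _
  · -- core
    have h := hcore t hts x hx
    have hcoord : ‖e.coord x‖ ≤ R₁ := e.norm_coord_le_of_not_mem_far hR₁0.le hx
    -- `1 ≤ (1 + R₁)⁴ (1 + ‖coord x‖)⁻⁴`
    have hone : 1 ≤ (1 + R₁) ^ 4 * (1 + ‖e.coord x‖) ^ (-4 : ℝ) := by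
      have hpos : 0 < 1 + ‖e.coord x‖ := by positivity
      rw [Real.rpow_neg hpos.le, show (4 : ℝ) = ((4 : ℕ) : ℝ) by norm_num, Real.rpow_natCast,
        ← div_eq_mul_inv, le_div_iff₀ (by positivity), one_mul]
      exact pow_le_pow_left₀ hpos.le (by linarith) 4
    calc |(Dt t).scalarCurvatureFn x - D.scalarCurvatureFn x| ≤ |t| * M := h
      _ = |t| * M * 1 := (mul_one _).symm
      _ ≤ |t| * M * ((1 + R₁) ^ 4 * (1 + ‖e.coord x‖) ^ (-4 : ℝ)) :=
          mul_le_mul_of_nonneg_left hone (by positivity)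
      _ = |t| * (M * (1 + R₁) ^ 4) * (1 + ‖e.coord x‖) ^ (-4 : ℝ) := by ring
      _ ≤ |t| * K * (1 + ‖e.coord x‖) ^ (-4 : ℝ) := by
          gcongr
          exact le_max_right _ _

end AFEnd

end Literature.Geometry.Lorentzian

end
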